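import Literature.NumberTheory.ConnesConsani2021.ScalingOperator
import Literature.NumberTheory.ConnesConsani2021.SchwartzKernels
import Literature.NumberTheory.ConnesConsani2021.SchwartzKernelsHS
import Literature.NumberTheory.ConnesConsani2021.ProlateProjections
import Literature.Analysis.Fourier.L2FourierReflection
import HarnessLib

/-!
# Connes–Consani 2021, Theorem 4.7 in the weak-trace typing, REDUCED to Prop. 2.2 (iii) (§2),
# eq. (spectral) (Prop. 4.5 (iii)) and the §4 identity — the `L²(ℝ)_ev`, `P`, `P̂`, `𝐒` bookkeeping
# (proof-layer infrastructure: theorems only, 0 definitions, 0 named facts)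

A. Connes, C. Consani, *Weil positivity and trace formula, the archimedean place*, Selecta Math. (N.S.)
27 (2021) 77 = arXiv:2006.13771 [bib: `ConnesConsani2021`].  Continuation of `ScalingOperator.lean`
(cell `rh-crit`, sub-cell `cc`, overflow row O4a = the "D6 glue"; the target is the hypothesis `hTr` of
`MainInequalityAssembly.weilArchPositivity_soninTrace_fine_of_spectralData`, i.e. the text of
`ArchimedeanTraceFormula.CC2021_thm_4_7_weak` / route item K1 `SoninTraceFormula`).

The printed proof of Thm. 4.7 (§4 p. 18, arXiv chunk p0018:L42–87) combines
(a) Prop. 2.2 (iii) (§2 p. 10): `Tr(ϑ(f) P P̂ P) = L(f) = W_∞(f) + D(f)`, with "`P` the multiplication by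
the characteristic function of `{|x| ≥ 1}` and `P̂ = 𝔽_{e_ℝ}⁻¹ P 𝔽_{e_ℝ}`" on `L²(ℝ)_ev` (§4 p. 15, chunk
p0015:L42–48) — tree: named fact `CC2021_prop_2_2_iii` (`SchwartzKernels.lean`), read as a
Hilbert–Schmidt series by `SchwartzKernelsHS.CC2021_prop_2_2_iii.hasSum_norm_sq`;
(b) the spectral decomposition `P P̂ P = Σ λ(n)² |ζ_n⟩⟨ζ_n| + 𝐒` on `L²(ℝ)_ev` (Prop. 4.5 (iii), eq.
(spectral) p. 17; "Sonin's space `S(1,1)` is the eigenspace of `PP̂P` for the eigenvalue `1`, so that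
`R = 𝐒`", p. 18) — tree: named fact `ProlateProjections.CC2021_prop_4_5_spectral`, vector-wise on
`evenPart`, with `P = outerProj`, `P̂ = outerProjHat`, `𝐒 = soninProjection 1 1`;
(c) the §4 identity `δ(ρ) = Σ λ(n)²⟨ζ_n | ϑ(ρ⁻¹) ζ_n⟩ + ε(ρ)` integrated against `f`:
`Σ λ(n)²⟨ζ_n|ϑ(f)ζ_n⟩ = D(f) − E(f)` — tree: `ArchimedeanTraceFormulaProofs.hasSum_re_soninTraceForm_prolate`
(seat t4, from Prop. 4.5 (ii), (iv), Rem. 4.6);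
into `Tr(ϑ(f)𝐒) = Tr(ϑ(f)PP̂P) − Σ λ(n)²⟨ζ_n|ϑ(f)ζ_n⟩ = W_∞(f) + E(f)`.  For `f = g ∗ g*` every trace in
sight is the Hilbert–Schmidt norm of a positive operator `B B*` (`B = ϑ(g)`), so no trace class is needed
(`Literature/Analysis/OperatorTheory/HilbertSchmidtPartialSums.lean`, `ScalingOperator.lean`).

This file supplies the operator bookkeeping between the three typings:

* **`L²(ℝ)_ev` and the Fourier transform.**  `fourier_mem_evenPart`, `fourierInv_mem_evenPart`: Mathlib's
  unitary `L²` Fourier transform preserves the even subspace (it commutes with the reflection isometry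
  `u ↦ u(−·)`; Schwartz density, as in `FluidPDE/TaoAveragedConjugation.fourier_conjL2`); hence the
  cut-offs `cutoffProj Λ`, `cutoffProjHat Λ`, `outerProj = P`, `outerProjHat = P̂` preserve `evenPart`
  ("rewriting the formula in `L²(ℝ)_ev`", p. 18) and the prolate vectors `η_n = 𝔽ξ_n`, `ψ_n = Pη_n`,
  `ζ_n` of Prop. 4.5 are even.
* **`𝓕⁻ = 𝓕` and `𝓕𝓕 = 1` on `L²(ℝ)_ev`** (append; from the generic
  `Literature/Analysis/Fourier/L2FourierReflection.lean`: `𝓕⁻ = R𝓕`, `𝓕𝓕 = R` with `R` the reflection):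
  `fourierInv_eq_fourier_of_mem_evenPart`, `fourier_fourier_of_mem_evenPart`,
  `fourierInv_fourierInv_of_mem_evenPart` (Prop. 4.5 (iii)–(iv) proofs: "using `ϑ(ρ) = 𝔽⁻¹ϑ(ρ⁻¹)𝔽` …",
  p. 17; the prolate instances `𝓕η_n = ξ_n`, `𝓕⁻ξ_n = η_n` are seat t3's
  `ProlateProjectionsProofs.fourier_prolateEta` / `fourierInv_prolateXi`, not restated here).
* **Sonin projections versus cut-offs.**  `soninSpace_zero_zero_eq_evenPart` (`S(0,0) = L²(ℝ)_ev`, both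
  cut-offs at `Λ = 0` being null, `cutoffProj_zero`), and on even vectors
  `soninProjection_one_zero_eq_outerProj` (`P = 𝐏_{S(1,0)}`), `soninProjection_zero_one_eq_outerProjHat`
  (`P̂ = 𝐏_{S(0,1)}`): the orthogonal projections onto `soninSpace 1 0` / `soninSpace 0 1` ARE CC's `P`,
  `P̂` on `L²(ℝ)_ev`, and they kill the odd part (`soninProjection_apply_soninProjection_zero_zero`).
* **(a) in operator form, on all of `L²(ℝ)`.**  `hasSum_norm_sq_cutoffs_scalingOp_of_prop_2_2_iii`: along
  every Hilbert basis `(e_k)` of `L²(ℝ)`, `Σ_k ‖𝐏_{S(0,1)} 𝐏_{S(1,0)} ϑ(g) e_k‖² = Re L(g ∗ g*)`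
  ("`Tr(ϑ(f) P P̂ P) = L(f)`" as the Hilbert–Schmidt norm of `P̂Pϑ(g)` restricted to even functions);
  `re_inner_cutoffSandwich`: `Re⟨x | 𝐏₁₀𝐏₀₁𝐏₁₀ x⟩ = ‖𝐏₀₁𝐏₁₀ x‖²`.
* **(b) as quadratic forms, on all of `L²(ℝ)`.**  `hasSum_sq_inner_prolateZeta_of_prop_4_5_spectral`:
  `Σ_n λ(n)² |⟨ζ_n | x⟩|² = Re⟨x | 𝐏₁₀𝐏₀₁𝐏₁₀ x⟩ − ‖𝐒 x‖²` for EVERY `x ∈ L²(ℝ)` (apply (spectral) to the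
  even part of `x`; all operators and the `ζ_n` only see the even part).
* **Thm. 4.7, weak form, from (a) + (b) + (c).**  `sum_re_soninTraceForm_le_of_prop_2_2_iii` (generic
  weights/vectors), `sum_re_soninTraceForm_le_of_prop_2_2_iii_of_spectral` (the prolate data of Prop. 4.5):
  every finite orthonormal family `(ξ_i)` of `S(1,1)` has `Σ_i Re⟨ξ_i | ϑ(g ∗ g*) ξ_i⟩ ≤ Re L(g ∗ g*) − A`
  whenever `Σ_n λ(n)² Re⟨ζ_n|ϑ(g ∗ g*)ζ_n⟩ = A`; and `soninTrace_partial_le_archW_add[_of_spectral]`: with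
  `A = Re D(g ∗ g*) − E` this reads `≤ Re W_∞(g ∗ g*) + E` — the `hTr` / `CC2021_thm_4_7_weak` shape, `E`
  being `Re E(g ∗ g*) = Re evenFunctional (ε ∘ exp) (g ∗ g*)` once (c) is supplied.

So after this file the weak Thm. 4.7 needs exactly the named facts `CC2021_prop_2_2_iii`,
`CC2021_prop_4_5_spectral` and the §4 inputs of (c) — no trace class (App. D Lemma 47 is off this path).
Label: RH-FREE operator bookkeeping at the archimedean place; bears_on W-C/W-P (apex input (A) `hTr`);
nothing here bears on the truth of RH.  Net debt delta 0.

## References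

* A. Connes, C. Consani, Selecta Math. (N.S.) 27 (2021) 77 = arXiv:2006.13771: Prop. 2.2 (iii) p. 10
  (chunk p0010:L20–L23), §4 p. 15 (chunk p0015:L42–L48: `P`, `P̂` on `L²(ℝ)_ev`), Def. 4.4 p. 16,
  Prop. 4.5 (iii) and eq. (spectral) pp. 16–17 (chunks p0016:L56–59, p0017:L59–63), Thm. 4.7 and its
  proof p. 18 (chunk p0018:L33–87). [ConnesConsani2021]
* M. Reed, B. Simon, *Methods of Modern Mathematical Physics I* (1972), Thm. II.3 (PDF p. 43), Thm. VI.18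
  (PDF p. 196), Thm. VI.22 (PDF p. 198) of the held copy. [ReedSimon1972]
-/

noncomputable section

open _root_.MeasureTheory Complex Set Filter FourierTransform
open scoped Real ComplexConjugate ENNReal InnerProductSpace Topology SchwartzMap

namespace Literature.NumberTheory.ConnesConsani2021

open Literature.NumberTheory.LFunctions Literature.Analysis.OperatorTheory

/-! ## `L²(ℝ)_ev` is stable under the Fourier transform and the cut-offs -/

section EvenFourier

/-- The reflection `u ↦ u(−·)` of `L²(ℝ)` (as the composition-with-`x ↦ −x` isometry) acts a.e. as
`x ↦ u(−x)`. [folklore] -/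
private theorem coeFn_reflect (u : Lp ℂ 2 (volume : Measure ℝ)) :
    ((Lp.compMeasurePreservingₗᵢ ℂ (fun x : ℝ => -x)
        (Measure.measurePreserving_neg (volume : Measure ℝ)) u : Lp ℂ 2 (volume : Measure ℝ)) : ℝ → ℂ)
      =ᵐ[volume] fun x => (u : ℝ → ℂ) (-x) :=
  Lp.coeFn_compMeasurePreserving u (Measure.measurePreserving_neg (volume : Measure ℝ))

/-- `u` is even iff it is fixed by the reflection isometry. [folklore] -/
private theorem mem_evenPart_iff_reflect {u : Lp ℂ 2 (volume : Measure ℝ)} :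
    u ∈ evenPart ↔
      Lp.compMeasurePreservingₗᵢ ℂ (fun x : ℝ => -x)
        (Measure.measurePreserving_neg (volume : Measure ℝ)) u = u := by
  rw [mem_evenPart_iff]
  constructor
  · intro h
    exact Lp.ext ((coeFn_reflect u).trans h)
  · intro h
    have h1 := coeFn_reflect u
    rw [h] at h1
    filter_upwards [h1] with x hx
    exact hx.symm

/-- The Fourier integral of `x ↦ f(−x)` is `w ↦ 𝓕f(−w)`. [folklore] -/
private theorem fourierIntegral_comp_neg (f : ℝ → ℂ) (w : ℝ) :
    𝓕 (fun x : ℝ => f (-x)) w = 𝓕 f (-w) := by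
  rw [← Real.fourierInv_eq_fourier_comp_neg, Real.fourierInv_eq_fourier_neg]

/-- **The `L²` Fourier transform commutes with the reflection `u ↦ u(−·)`** (checked on the dense
Schwartz functions, where both sides are the Fourier integral of `x ↦ φ(−x)`). [folklore] -/
private theorem fourier_reflect (u : Lp ℂ 2 (volume : Measure ℝ)) :
    ((𝓕 (Lp.compMeasurePreservingₗᵢ ℂ (fun x : ℝ => -x)
        (Measure.measurePreserving_neg (volume : Measure ℝ)) u) : Lp ℂ 2 (volume : Measure ℝ))) =
      Lp.compMeasurePreservingₗᵢ ℂ (fun x : ℝ => -x)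
        (Measure.measurePreserving_neg (volume : Measure ℝ)) (𝓕 u : Lp ℂ 2 (volume : Measure ℝ)) := by
  have hneg := Measure.measurePreserving_neg (volume : Measure ℝ)
  have hq : Measure.QuasiMeasurePreserving (fun x : ℝ => -x) volume volume := hneg.quasiMeasurePreserving
  have hd := SchwartzMap.denseRange_toLpCLM (E := ℝ) (F := ℂ) (p := 2) (μ := (volume : Measure ℝ))
    ENNReal.ofNat_ne_top
  refine congrFun (hd.equalizer
    ((continuous_fourier (E := Lp ℂ 2 (volume : Measure ℝ))).comp
      (Lp.compMeasurePreservingₗᵢ ℂ (fun x : ℝ => -x) hneg).continuous)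
    ((Lp.compMeasurePreservingₗᵢ ℂ (fun x : ℝ => -x) hneg).continuous.comp
      (continuous_fourier (E := Lp ℂ 2 (volume : Measure ℝ)))) ?_) u
  funext φ
  simp only [Function.comp_apply, SchwartzMap.toLpCLM_apply]
  -- `φ(−·)` is in `L¹ ∩ L²`
  have hint : Integrable (⇑φ ∘ fun x : ℝ => -x) (volume : Measure ℝ) :=
    hneg.integrable_comp_of_integrable φ.integrable
  have hmem : MemLp (⇑φ ∘ fun x : ℝ => -x) 2 (volume : Measure ℝ) :=
    (φ.memLp 2 (volume : Measure ℝ)).comp_measurePreserving hneg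
  -- the reflected Schwartz function, as an element of `L²`
  have hRφ : Lp.compMeasurePreservingₗᵢ ℂ (fun x : ℝ => -x) hneg (φ.toLp 2) = hmem.toLp _ := by
    apply Lp.ext
    filter_upwards [coeFn_reflect (φ.toLp 2), hq.ae_eq (φ.coeFn_toLp 2 (volume : Measure ℝ)),
      hmem.coeFn_toLp] with x h1 h2 h3
    simp only [Function.comp_apply] at h2
    rw [h1, h3, Function.comp_apply, h2]
  rw [hRφ, SchwartzMap.toLp_fourier_eq]
  apply Lp.ext
  filter_upwards [Literature.Analysis.FluidPDE.FourierNS.fourier_toLp_ae_eq hint hmem,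
    coeFn_reflect ((𝓕 φ).toLp 2), hq.ae_eq ((𝓕 φ).coeFn_toLp 2 (volume : Measure ℝ))] with w h1 h2 h3
  simp only [Function.comp_apply] at h3
  rw [h1, h2, h3, SchwartzMap.fourier_coe, Function.comp_def]
  exact fourierIntegral_comp_neg φ w

/-- **`𝔽_{e_ℝ}` preserves `L²(ℝ)_ev`** (the Fourier transform of an even function is even; used
throughout §4, where `P̂ = 𝔽_{e_ℝ}⁻¹P𝔽_{e_ℝ}` acts on `L²(ℝ)_ev`, p. 15).
[cite: ConnesConsani2021, §4 p. 15 (chunk p0015:L42–L48)] -/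
theorem fourier_mem_evenPart {u : Lp ℂ 2 (volume : Measure ℝ)} (hu : u ∈ evenPart) :
    (𝓕 u : Lp ℂ 2 (volume : Measure ℝ)) ∈ evenPart := by
  rw [mem_evenPart_iff_reflect] at hu ⊢
  rw [← fourier_reflect, hu]

/-- **`𝔽_{e_ℝ}⁻¹` preserves `L²(ℝ)_ev`.** [cite: ConnesConsani2021, §4 p. 15 (chunk p0015:L42–L48)] -/
theorem fourierInv_mem_evenPart {u : Lp ℂ 2 (volume : Measure ℝ)} (hu : u ∈ evenPart) :
    (𝓕⁻ u : Lp ℂ 2 (volume : Measure ℝ)) ∈ evenPart := by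
  rw [mem_evenPart_iff_reflect] at hu ⊢
  have h1 : ((𝓕 (Lp.compMeasurePreservingₗᵢ ℂ (fun x : ℝ => -x)
      (Measure.measurePreserving_neg (volume : Measure ℝ)) (𝓕⁻ u : Lp ℂ 2 (volume : Measure ℝ))) :
        Lp ℂ 2 (volume : Measure ℝ))) =
      ((𝓕 (𝓕⁻ u : Lp ℂ 2 (volume : Measure ℝ))) : Lp ℂ 2 (volume : Measure ℝ)) := by
    rw [fourier_reflect, fourier_fourierInv_eq, hu]
  have h2 := congrArg (fun v : Lp ℂ 2 (volume : Measure ℝ) => (𝓕⁻ v : Lp ℂ 2 (volume : Measure ℝ))) h1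
  simpa only [fourierInv_fourier_eq] using h2

/-- The cut-off `𝒫_Λ` (multiplication by `1_{[−Λ,Λ]}`, a symmetric set) preserves `L²(ℝ)_ev`.
[cite: ConnesConsani2021, §4 p. 15 eq. (complementproj) (chunk p0015:L42–L48)] -/
theorem cutoffProj_mem_evenPart (Λ : ℝ) {u : Lp ℂ 2 (volume : Measure ℝ)} (hu : u ∈ evenPart) :
    cutoffProj Λ u ∈ evenPart := by
  rw [mem_evenPart_iff] at hu ⊢
  have h := cutoffProj_coeFn Λ u
  have hq : Measure.QuasiMeasurePreserving (fun x : ℝ => -x) volume volume :=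
    (Measure.measurePreserving_neg (volume : Measure ℝ)).quasiMeasurePreserving
  filter_upwards [h, hq.ae_eq h, hu] with x h1 h2 h3
  simp only [Function.comp_apply] at h2
  rw [h2, h1]
  by_cases hx : x ∈ Icc (-Λ) Λ
  · have hx' : -x ∈ Icc (-Λ) Λ := by
      rw [mem_Icc] at hx ⊢
      constructor <;> linarith [hx.1, hx.2]
    rw [indicator_of_mem hx', indicator_of_mem hx, h3]
  · have hx' : -x ∉ Icc (-Λ) Λ := fun h' => hx (by
      rw [mem_Icc] at h' ⊢
      constructor <;> linarith [h'.1, h'.2])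
    rw [indicator_of_notMem hx', indicator_of_notMem hx]

/-- The dual cut-off `𝒫̂_Λ = 𝔽⁻¹𝒫_Λ𝔽` preserves `L²(ℝ)_ev`.
[cite: ConnesConsani2021, §4 p. 15 eq. (complementproj) (chunk p0015:L42–L48)] -/
theorem cutoffProjHat_mem_evenPart (Λ : ℝ) {u : Lp ℂ 2 (volume : Measure ℝ)} (hu : u ∈ evenPart) :
    cutoffProjHat Λ u ∈ evenPart := by
  rw [cutoffProjHat_apply]
  exact fourierInv_mem_evenPart (cutoffProj_mem_evenPart Λ (fourier_mem_evenPart hu))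

/-- `P = 1 − 𝒫₁` preserves `L²(ℝ)_ev`. [cite: ConnesConsani2021, §4 p. 15 eq. (complementproj) (chunk p0015:L42–L48)] -/
theorem outerProj_mem_evenPart {u : Lp ℂ 2 (volume : Measure ℝ)} (hu : u ∈ evenPart) :
    outerProj u ∈ evenPart := by
  rw [outerProj_apply]
  exact evenPart.sub_mem hu (cutoffProj_mem_evenPart 1 hu)

/-- `P̂ = 1 − 𝒫̂₁` preserves `L²(ℝ)_ev`. [cite: ConnesConsani2021, §4 p. 15 eq. (complementproj) (chunk p0015:L42–L48)] -/
theorem outerProjHat_mem_evenPart {u : Lp ℂ 2 (volume : Measure ℝ)} (hu : u ∈ evenPart) :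
    outerProjHat u ∈ evenPart := by
  rw [outerProjHat_apply]
  exact evenPart.sub_mem hu (cutoffProjHat_mem_evenPart 1 hu)

/-- `η_n = 𝔽_{e_ℝ}ξ_n` is even. [cite: ConnesConsani2021, Prop. 4.5 (i) §4 p. 16 (chunk p0016:L50)] -/
theorem prolateEta_mem_evenPart (n : ℕ) : prolateEta n ∈ evenPart := by
  unfold prolateEta
  exact fourier_mem_evenPart (prolateXi_mem_evenPart n)

/-- `ψ_n = Pη_n` is even. [cite: ConnesConsani2021, Prop. 4.5 (i) §4 p. 16 (chunk p0016:L50)] -/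
theorem prolatePsi_mem_evenPart (n : ℕ) : prolatePsi n ∈ evenPart := by
  unfold prolatePsi
  exact outerProj_mem_evenPart (prolateEta_mem_evenPart n)

/-- `ζ_n = ψ_n/√(1 − λ(n)²)` is even ("`L²(ℝ)_ev`", Prop. 4.5 (iii)).
[cite: ConnesConsani2021, Prop. 4.5 (iii) §4 p. 16 (chunk p0016:L56–L59)] -/
theorem prolateZeta_mem_evenPart (n : ℕ) : prolateZeta n ∈ evenPart := by
  unfold prolateZeta
  exact evenPart.smul_mem _ (prolatePsi_mem_evenPart n)

end EvenFourier

/-! ## Sonin projections versus the cut-offs `P`, `P̂` on `L²(ℝ)_ev` -/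

section SoninVsCutoff

/-- `𝒫₀ = 0`: the cut-off at `Λ = 0` multiplies by the indicator of the null set `{0}`.
[cite: ConnesConsani2021, §4 p. 15 eq. (complementproj) (chunk p0015:L42–L48)] -/
theorem cutoffProj_zero : cutoffProj 0 = 0 := by
  ext1 ξ
  rw [zero_apply]
  apply Lp.ext
  have hne0 : ∀ᵐ x : ℝ, x ≠ 0 := by simp [ae_iff]
  filter_upwards [cutoffProj_coeFn 0 ξ, Lp.coeFn_zero ℂ 2 (volume : Measure ℝ), hne0] with x h1 h2 h3
  rw [h1, h2, Pi.zero_apply, neg_zero, Icc_self, indicator_of_notMem (by simpa using h3)]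

/-- `𝒫̂₀ = 0`. [cite: ConnesConsani2021, §4 p. 15 eq. (complementproj) (chunk p0015:L42–L48)] -/
theorem cutoffProjHat_zero : cutoffProjHat 0 = 0 := by
  ext1 ξ
  rw [cutoffProjHat_apply, cutoffProj_zero, zero_apply,
    zero_apply]
  exact fourierInv_zero

/-- `S(α, β) ⊆ L²(ℝ)_ev` (first clause of Definition 4.4). [cite: ConnesConsani2021, Def. 4.4 §4 p. 16] -/
theorem soninSpace_le_evenPart (α β : ℝ) : soninSpace α β ≤ evenPart :=
  fun _ h => mem_evenPart_iff.mpr h.1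

/-- **`S(0, 0) = L²(ℝ)_ev`**: with `α = β = 0` the two vanishing conditions of Definition 4.4 bear on the
null set `{0}` only. [cite: ConnesConsani2021, Def. 4.4 §4 p. 16] -/
theorem soninSpace_zero_zero_eq_evenPart : soninSpace 0 0 = evenPart := by
  refine le_antisymm (soninSpace_le_evenPart 0 0) fun ξ hξ => ?_
  rw [mem_soninSpace_iff_cutoffProj]
  refine ⟨hξ, ?_, ?_⟩
  · rw [cutoffProj_zero, zero_apply]
  · rw [cutoffProjHat_zero, zero_apply]

/-- `S(α, β) ⊆ S(0, 0)`. [cite: ConnesConsani2021, Def. 4.4 §4 p. 16] -/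
theorem soninSpace_le_zero_zero (α β : ℝ) : soninSpace α β ≤ soninSpace 0 0 := by
  rw [soninSpace_zero_zero_eq_evenPart]
  exact soninSpace_le_evenPart α β

/-- `𝐏_{S(0,0)} ξ = ξ ↔ ξ` is even. [cite: ConnesConsani2021, Def. 4.4 §4 p. 16] -/
theorem soninProjection_zero_zero_eq_self_iff {ξ : Lp ℂ 2 (volume : Measure ℝ)} :
    soninProjection 0 0 ξ = ξ ↔ ξ ∈ evenPart := by
  rw [soninProjection_eq_self_iff, soninSpace_zero_zero_eq_evenPart]

/-- `𝐏_{S(0,0)} x` is even. [cite: ConnesConsani2021, Def. 4.4 §4 p. 16] -/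
theorem soninProjection_zero_zero_mem_evenPart (x : Lp ℂ 2 (volume : Measure ℝ)) :
    soninProjection 0 0 x ∈ evenPart := by
  rw [← soninSpace_zero_zero_eq_evenPart]
  exact soninProjection_mem 0 0 x

/-- **The Sonin projections kill the odd part**: `𝐏_{S(α,β)} 𝐏_{S(0,0)} = 𝐏_{S(α,β)}`.
[cite: ConnesConsani2021, Def. 4.4 §4 p. 16; Thm. 4.7 §4 p. 18] -/
theorem soninProjection_apply_soninProjection_zero_zero (α β : ℝ) (x : Lp ℂ 2 (volume : Measure ℝ)) :
    soninProjection α β (soninProjection 0 0 x) = soninProjection α β x := by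
  have h := Submodule.starProjection_comp_starProjection_of_le (soninSpace_le_zero_zero α β)
  exact congrFun (congrArg DFunLike.coe h) x

/-- `⟨ζ | 𝐏_{S(0,0)} x⟩ = ⟨ζ | x⟩` for even `ζ`. [cite: ConnesConsani2021, Def. 4.4 §4 p. 16] -/
theorem inner_soninProjection_zero_zero_right {ζ : Lp ℂ 2 (volume : Measure ℝ)} (hζ : ζ ∈ evenPart)
    (x : Lp ℂ 2 (volume : Measure ℝ)) :
    ⟪ζ, soninProjection 0 0 x⟫_ℂ = ⟪ζ, x⟫_ℂ := by
  have hfix : soninProjection 0 0 ζ = ζ := soninProjection_zero_zero_eq_self_iff.mpr hζ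
  unfold soninProjection at hfix ⊢
  rw [← Submodule.inner_starProjection_left_eq_right, hfix]

/-- An orthogonal projection `𝐏_K` equals `1 − T` on `u` as soon as `T` is self-adjoint, vanishes on `K`,
and `u − Tu ∈ K`. [folklore] -/
private theorem starProjection_eq_sub {K : Submodule ℂ (Lp ℂ 2 (volume : Measure ℝ))}
    [K.HasOrthogonalProjection]
    {T : Lp ℂ 2 (volume : Measure ℝ) →L[ℂ] Lp ℂ 2 (volume : Measure ℝ)} (hT : IsSelfAdjoint T)
    (hK : ∀ w ∈ K, T w = 0) {u : Lp ℂ 2 (volume : Measure ℝ)} (hu : u - T u ∈ K) :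
    K.starProjection u = u - T u :=
  Submodule.eq_starProjection_of_mem_of_inner_eq_zero hu fun w hw => by
    rw [sub_sub_cancel, ← ContinuousLinearMap.adjoint_inner_right, hT.adjoint_eq, hK w hw,
      inner_zero_right]

/-- **`P = 𝐏_{S(1,0)}` on `L²(ℝ)_ev`**: for even `y ∈ L²(ℝ)` the orthogonal projection of `y` onto
`soninSpace 1 0` (even functions vanishing a.e. on `[−1, 1]`) is "the multiplication by the characteristic
function of `{x : |x| ≥ 1}`" (§4 p. 15), i.e. CC's `P = outerProj`: `Py` is even and killed by `𝒫₁`,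
while `y − Py = 𝒫₁y ⊥ S(1,0)` (`𝒫₁` self-adjoint, `= 0` on `S(1,0)`).
[cite: ConnesConsani2021, §4 p. 15 eq. (complementproj) (chunk p0015:L42–L48)] -/
theorem soninProjection_one_zero_eq_outerProj {y : Lp ℂ 2 (volume : Measure ℝ)} (hy : y ∈ evenPart) :
    soninProjection 1 0 y = outerProj y := by
  rw [outerProj_apply]
  unfold soninProjection
  refine starProjection_eq_sub (cutoffProj_isSelfAdjoint 1)
    (fun w hw => (mem_soninSpace_iff_cutoffProj.1 hw).2.1) ?_
  rw [← outerProj_apply, mem_soninSpace_iff_cutoffProj]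
  refine ⟨outerProj_mem_evenPart hy, ?_, ?_⟩
  · rw [outerProj_apply, map_sub, ← mul_apply_eq_comp, (cutoffProj_idem 1).eq, sub_self]
  · rw [cutoffProjHat_zero, zero_apply]

/-- `𝐏_{S(1,0)} y = P y = cutoffP y` a.e., for even `y` (dictionary with the statement layer's
function-level `P`). [cite: ConnesConsani2021, §4 p. 15 eq. (complementproj) (chunk p0015:L42–L48)] -/
theorem soninProjection_one_zero_coeFn_of_even {y : Lp ℂ 2 (volume : Measure ℝ)} (hy : y ∈ evenPart) :
    (soninProjection 1 0 y : ℝ → ℂ) =ᵐ[volume] cutoffP (y : ℝ → ℂ) := by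
  rw [soninProjection_one_zero_eq_outerProj hy]
  exact outerProj_coeFn y

/-- **`P̂ = 𝐏_{S(0,1)}` on `L²(ℝ)_ev`**: for even `y ∈ L²(ℝ)` the orthogonal projection of `y` onto
`soninSpace 0 1` (even functions whose Fourier transform vanishes a.e. on `[−1, 1]`) is CC's
`P̂ = 𝔽_{e_ℝ}⁻¹P𝔽_{e_ℝ} = outerProjHat` (§4 p. 15): `P̂y` is even (Fourier-evenness) and killed by `𝒫̂₁`
(idempotency), while `y − P̂y = 𝒫̂₁y ⊥ S(0,1)` (`𝒫̂₁` self-adjoint, `= 0` on `S(0,1)`).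
[cite: ConnesConsani2021, §4 p. 15 eq. (complementproj) (chunk p0015:L42–L48); Def. 4.4 p. 16] -/
theorem soninProjection_zero_one_eq_outerProjHat {y : Lp ℂ 2 (volume : Measure ℝ)} (hy : y ∈ evenPart) :
    soninProjection 0 1 y = outerProjHat y := by
  rw [outerProjHat_apply]
  unfold soninProjection
  refine starProjection_eq_sub (isStarProjection_cutoffProjHat 1).isSelfAdjoint
    (fun w hw => (mem_soninSpace_iff_cutoffProj.1 hw).2.2) ?_
  rw [← outerProjHat_apply, mem_soninSpace_iff_cutoffProj]
  refine ⟨outerProjHat_mem_evenPart hy, ?_, ?_⟩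
  · rw [cutoffProj_zero, zero_apply]
  · rw [outerProjHat_apply, map_sub, ← mul_apply_eq_comp,
      (isStarProjection_cutoffProjHat 1).isIdempotentElem.eq, sub_self]

/-- `P P̂ P` on `L²(ℝ)_ev` is `𝐏₁₀𝐏₀₁𝐏₁₀` (on even vectors).
[cite: ConnesConsani2021, Prop. 2.2 (iii) p. 10; §4 p. 15 eq. (complementproj)] -/
theorem outerProj_outerProjHat_outerProj_eq {y : Lp ℂ 2 (volume : Measure ℝ)} (hy : y ∈ evenPart) :
    outerProj (outerProjHat (outerProj y)) =
      soninProjection 1 0 (soninProjection 0 1 (soninProjection 1 0 y)) := by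
  have e10 : soninProjection 1 0 y ∈ evenPart := soninSpace_le_evenPart 1 0 (soninProjection_mem 1 0 y)
  have e01 : soninProjection 0 1 (soninProjection 1 0 y) ∈ evenPart :=
    soninSpace_le_evenPart 0 1 (soninProjection_mem 0 1 _)
  rw [← soninProjection_one_zero_eq_outerProj hy, ← soninProjection_zero_one_eq_outerProjHat e10,
    ← soninProjection_one_zero_eq_outerProj e01]

end SoninVsCutoff

/-! ## (a) Prop. 2.2 (iii) as a Hilbert–Schmidt identity on `L²(ℝ)` -/

section Reduction

variable {g : ℝ → ℂ}

/-- A test function is integrable. [folklore] -/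
private theorem integrable_of_isWeilTest (hg : IsWeilTest g) : Integrable g :=
  hg.1.continuous.integrable_of_hasCompactSupport hg.2

/-- **`CC2021_prop_2_2_iii` along a Hilbert basis of `P̂ L²(ℝ)_ev`, Sonin-projection form**: for a test
function `g` and every Hilbert basis `(b_j)` of `soninSpace 0 1`, `Σ_j ‖ϑ(g)* 𝐏₁₀ b_j‖² = Re L(g ∗ g*)`
(`SchwartzKernelsHS.CC2021_prop_2_2_iii.hasSum_norm_sq` with `P b_j = 𝐏₁₀ b_j`, the `b_j` being even).
[cite: ConnesConsani2021, Prop. 2.2 (iii) p. 10 (chunk p0010:L20–L23)] [cite: ReedSimon1972, Thm. VI.18, PDF p. 196] -/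
theorem hasSum_norm_sq_adjoint_scalingOp_cutoff_of_prop_2_2_iii (h : CC2021_prop_2_2_iii)
    (hg : IsWeilTest g) {ι : Type*} (b : HilbertBasis ι ℂ (soninSpace 0 1)) :
    HasSum (fun j => ‖ContinuousLinearMap.adjoint (scalingOp g)
        (soninProjection 1 0 ((b j : soninSpace 0 1) : Lp ℂ 2 (volume : Measure ℝ)))‖ ^ 2)
      (traceL (weilConv g (weilReflect g))).re := by
  refine (h.hasSum_norm_sq hg b).congr_fun fun j => ?_
  rw [soninProjection_one_zero_eq_outerProj
    (soninSpace_le_evenPart 0 1 (Submodule.coe_mem (b j)))]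

/-- **"`Tr(ϑ(f) P P̂ P) = L(f)`" as the Hilbert–Schmidt norm of `P̂ P ϑ(g)` on `L²(ℝ)`**: for a test
function `g`, `f = g ∗ g*`, and every Hilbert basis `(e_k)` of `L²(ℝ)`,
`Σ_k ‖𝐏₀₁ 𝐏₁₀ ϑ(g) e_k‖² = Re L(f) = Re(W_∞(f) + D(f))` (from the previous identity through
`Σ_k ‖𝐏_V R e_k‖² = Σ_j ‖R† b_j‖²`, `R = 𝐏₁₀ ϑ(g)`, `R† = ϑ(g)* 𝐏₁₀`; the odd part of `L²(ℝ)` contributes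
nothing since `𝐏₁₀` kills it).
[cite: ConnesConsani2021, Prop. 2.2 (iii) p. 10 (chunk p0010:L20–L23)] [cite: ReedSimon1972, Thm. VI.22, PDF p. 198] -/
theorem hasSum_norm_sq_cutoffs_scalingOp_of_prop_2_2_iii (h : CC2021_prop_2_2_iii)
    (hg : IsWeilTest g) {κ : Type*} (e : HilbertBasis κ ℂ (Lp ℂ 2 (volume : Measure ℝ))) :
    HasSum (fun k => ‖soninProjection 0 1 (soninProjection 1 0 (scalingOp g (e k)))‖ ^ 2)
      (traceL (weilConv g (weilReflect g))).re := by
  obtain ⟨w, b, -⟩ := exists_hilbertBasis ℂ (soninSpace 0 1)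
  have h1 := hasSum_norm_sq_adjoint_scalingOp_cutoff_of_prop_2_2_iii h hg b
  have hadj : ContinuousLinearMap.adjoint (soninProjection 1 0 ∘L scalingOp g) =
      ContinuousLinearMap.adjoint (scalingOp g) ∘L soninProjection 1 0 := by
    rw [ContinuousLinearMap.adjoint_comp]
    congr 1
    exact (isSelfAdjoint_starProjection (soninSpace 1 0)).adjoint_eq
  have h2 := (hasSum_norm_sq_starProjection_apply_iff (V := soninSpace 0 1) b e
    (soninProjection 1 0 ∘L scalingOp g) (L := (traceL (weilConv g (weilReflect g))).re)).2
  rw [hadj] at h2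
  exact h2 h1

/-- **`Re⟨x | P P̂ P x⟩ = ‖P̂ P x‖²`** ("the positive operator `P P̂ P`", proof of Prop. 2.2 (iii)), with
`P = soninProjection 1 0`, `P̂ = soninProjection 0 1` (`re_inner_starProjection_sandwich`).
[cite: ConnesConsani2021, Prop. 2.2 (iii) p. 10] -/
theorem re_inner_cutoffSandwich (x : Lp ℂ 2 (volume : Measure ℝ)) :
    (⟪x, soninProjection 1 0 (soninProjection 0 1 (soninProjection 1 0 x))⟫_ℂ).re =
      ‖soninProjection 0 1 (soninProjection 1 0 x)‖ ^ 2 := by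
  have h := re_inner_starProjection_sandwich (𝕜 := ℂ) (U := soninSpace 1 0) (W := soninSpace 0 1) x
  rw [RCLike.re_to_complex] at h
  exact h

/-! ## (b) eq. (spectral) as a quadratic-form identity on all of `L²(ℝ)` -/

/-- **Eq. (spectral) as quadratic forms on `L²(ℝ)`**: from `CC2021_prop_4_5_spectral`
(`P P̂ P = Σ λ(n)²|ζ_n⟩⟨ζ_n| + 𝐒` vector-wise on `L²(ℝ)_ev`), for EVERY `x ∈ L²(ℝ)`,
`Σ_n λ(n)² |⟨ζ_n | x⟩|² = Re⟨x | 𝐏₁₀𝐏₀₁𝐏₁₀ x⟩ − ‖𝐒 x‖²`: apply (spectral) to the even part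
`y = 𝐏_{S(0,0)} x`, note `⟨ζ_n | y⟩ = ⟨ζ_n | x⟩` (`ζ_n` even), `PP̂Py = 𝐏₁₀𝐏₀₁𝐏₁₀ x`, `𝐒y = 𝐒x`, and pair
with `x` (`Re⟨x | 𝐒x⟩ = ‖𝐒x‖²`).  This is hypothesis `hQ` of `ScalingOperator.sum_re_soninTraceForm_le_of_decomposition`.
[cite: ConnesConsani2021, Prop. 4.5 (iii) proof §4 p. 17 eq. (spectral) (chunk p0017:L59–L63); Thm. 4.7 proof p. 18 (chunk p0018:L83–87)] -/
theorem hasSum_sq_inner_prolateZeta_of_prop_4_5_spectral (h : CC2021_prop_4_5_spectral)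
    (x : Lp ℂ 2 (volume : Measure ℝ)) :
    HasSum (fun n : ℕ => prolateEigen n ^ 2 * ‖⟪prolateZeta n, x⟫_ℂ‖ ^ 2)
      ((⟪x, soninProjection 1 0 (soninProjection 0 1 (soninProjection 1 0 x))⟫_ℂ).re
        - ‖soninProjection 1 1 x‖ ^ 2) := by
  have hye : soninProjection 0 0 x ∈ evenPart := soninProjection_zero_zero_mem_evenPart x
  have H := h _ hye
  have e3 : outerProj (outerProjHat (outerProj (soninProjection 0 0 x))) =
      soninProjection 1 0 (soninProjection 0 1 (soninProjection 1 0 x)) := by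
    rw [outerProj_outerProjHat_outerProj_eq hye, soninProjection_apply_soninProjection_zero_zero]
  have e4 : soninProjection 1 1 (soninProjection 0 0 x) = soninProjection 1 1 x :=
    soninProjection_apply_soninProjection_zero_zero 1 1 x
  have e5 : (fun n : ℕ =>
        ((prolateEigen n : ℂ) ^ 2 * ⟪prolateZeta n, soninProjection 0 0 x⟫_ℂ) • prolateZeta n) =
      fun n : ℕ => ((prolateEigen n : ℂ) ^ 2 * ⟪prolateZeta n, x⟫_ℂ) • prolateZeta n := by
    funext n
    rw [inner_soninProjection_zero_zero_right (prolateZeta_mem_evenPart n)]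
  rw [e3, e4, e5] at H
  -- pair with `x`
  have H2 := (innerSL ℂ x).hasSum H
  simp only [innerSL_apply_apply, inner_smul_right, inner_sub_right] at H2
  have H3 := Complex.hasSum_re H2
  have hS : (⟪x, soninProjection 1 1 x⟫_ℂ).re = ‖soninProjection 1 1 x‖ ^ 2 := by
    have h' := re_inner_starProjection_eq_norm_sq (𝕜 := ℂ) (V := soninSpace 1 1) x
    rw [RCLike.re_to_complex] at h'
    exact h'
  rw [Complex.sub_re, hS] at H3
  refine H3.congr_fun fun n => ?_
  change prolateEigen n ^ 2 * ‖⟪prolateZeta n, x⟫_ℂ‖ ^ 2 =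
    ((prolateEigen n : ℂ) ^ 2 * ⟪prolateZeta n, x⟫_ℂ * ⟪x, prolateZeta n⟫_ℂ).re
  rw [← inner_conj_symm x (prolateZeta n), mul_assoc, Complex.mul_conj, ← Complex.ofReal_pow,
    ← Complex.ofReal_mul, Complex.ofReal_re, Complex.normSq_eq_norm_sq]

/-! ## Theorem 4.7 (weak form) from Prop. 2.2 (iii), eq. (spectral) and the §4 identity -/

/-- **Thm. 4.7's weak form reduced to the printed inputs (generic weights).**  Let `g` be a test function,
`f = g ∗ g*`, `P = soninProjection 1 0`, `P̂ = soninProjection 0 1`, `𝐒 = soninProjection 1 1`.  Assume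
(a) Prop. 2.2 (iii) (`CC2021_prop_2_2_iii`: `Tr(ϑ(f)PP̂P) = L(f)`);
(b) a decomposition of `P P̂ P` as quadratic forms on `L²(ℝ)`:
`Re⟨x | PP̂P x⟩ − ‖𝐒 x‖² = Σ_n μ_n |⟨χ_n | x⟩|²` with `μ_n ≥ 0` (eq. (spectral):
`hasSum_sq_inner_prolateZeta_of_prop_4_5_spectral`);
(c) `Σ_n μ_n Re⟨χ_n | ϑ(f) χ_n⟩ = A`.
Then every finite orthonormal family `(ξ_i)` of Sonin's space `S(1,1)` satisfies
`Σ_i Re⟨ξ_i | ϑ(f) ξ_i⟩ ≤ Re L(f) − A` — the printed "`Tr(ϑ(f)𝐒) = Tr(ϑ(f)PP̂P) − Σ λ(n)²⟨ζ_n|ϑ(f)ζ_n⟩`"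
(proof of Thm. 4.7, last step) with "partial sums `≤` trace", and NO trace class.
[cite: ConnesConsani2021, Thm. 4.7 §4 p. 18 (proof, chunk p0018:L77–L87); Prop. 2.2 (iii) p. 10; Prop. 4.5 (iii) eq. (spectral) pp. 16–17] -/
theorem sum_re_soninTraceForm_le_of_prop_2_2_iii (h : CC2021_prop_2_2_iii) (hg : IsWeilTest g)
    {ι' : Type*} {χ : ι' → Lp ℂ 2 (volume : Measure ℝ)} {μ : ι' → ℝ} (hμ : ∀ n, 0 ≤ μ n)
    (hQ : ∀ x : Lp ℂ 2 (volume : Measure ℝ), HasSum (fun n => μ n * ‖⟪χ n, x⟫_ℂ‖ ^ 2)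
      ((⟪x, soninProjection 1 0 (soninProjection 0 1 (soninProjection 1 0 x))⟫_ℂ).re
        - ‖soninProjection 1 1 x‖ ^ 2))
    {A : ℝ}
    (hA : HasSum (fun n => μ n * (soninTraceForm (weilConv g (weilReflect g)) (χ n)).re) A)
    {n : ℕ} (ξ : Fin n → Lp ℂ 2 (volume : Measure ℝ)) (hξ : Orthonormal ℂ ξ)
    (hS : ∀ i, ξ i ∈ soninSpace 1 1) :
    ∑ i, (soninTraceForm (weilConv g (weilReflect g)) (ξ i)).re ≤
      (traceL (weilConv g (weilReflect g))).re - A := by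
  obtain ⟨w, e, -⟩ := exists_hilbertBasis ℂ (Lp ℂ 2 (volume : Measure ℝ))
  have hL := hasSum_norm_sq_cutoffs_scalingOp_of_prop_2_2_iii h hg e
  exact sum_re_soninTraceForm_le_of_decomposition (integrable_of_isWeilTest hg) hμ
    (Q := soninProjection 1 0 ∘L soninProjection 0 1 ∘L soninProjection 1 0)
    (C := soninProjection 0 1 ∘L soninProjection 1 0)
    (fun x => re_inner_cutoffSandwich x) hQ e hL hA ξ hξ hS

/-- **The `hTr` / `SoninTraceFormula` shape (generic weights).**  Under (a), (b) of
`sum_re_soninTraceForm_le_of_prop_2_2_iii` and the §4 identity in integrated form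
(c′) `Σ_n μ_n Re⟨χ_n | ϑ(f) χ_n⟩ = Re D(f) − E` (display (sonine3) of the proof of Thm. 4.7,
`δ(ρ) = Σ λ(n)²⟨ζ_n|ϑ(ρ⁻¹)ζ_n⟩ + ε(ρ)`, integrated against `f(ρ⁻¹)d*ρ`: `E = Re ∫ f(ρ⁻¹)ε(ρ)d*ρ`, the
value of the even functional `E₊(f)`), every finite orthonormal family `(ξ_i)` of `S(1,1)` satisfies
`Σ_i Re⟨ξ_i | ϑ(f) ξ_i⟩ ≤ Re W_∞(f) + E` (`L = W_∞ + D`, `traceL = archW + remainderD`).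
[cite: ConnesConsani2021, Thm. 4.7 §4 p. 18 (statement (sonine0) and proof, chunk p0018:L33–L87)] -/
theorem soninTrace_partial_le_archW_add (h : CC2021_prop_2_2_iii) (hg : IsWeilTest g)
    {ι' : Type*} {χ : ι' → Lp ℂ 2 (volume : Measure ℝ)} {μ : ι' → ℝ} (hμ : ∀ n, 0 ≤ μ n)
    (hQ : ∀ x : Lp ℂ 2 (volume : Measure ℝ), HasSum (fun n => μ n * ‖⟪χ n, x⟫_ℂ‖ ^ 2)
      ((⟪x, soninProjection 1 0 (soninProjection 0 1 (soninProjection 1 0 x))⟫_ℂ).re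
        - ‖soninProjection 1 1 x‖ ^ 2))
    {E : ℝ}
    (hA : HasSum (fun n => μ n * (soninTraceForm (weilConv g (weilReflect g)) (χ n)).re)
      ((remainderD (weilConv g (weilReflect g))).re - E))
    {n : ℕ} (ξ : Fin n → Lp ℂ 2 (volume : Measure ℝ)) (hξ : Orthonormal ℂ ξ)
    (hS : ∀ i, ξ i ∈ soninSpace 1 1) :
    ∑ i, (soninTraceForm (weilConv g (weilReflect g)) (ξ i)).re ≤
      (archW (weilConv g (weilReflect g))).re + E := by
  have h1 := sum_re_soninTraceForm_le_of_prop_2_2_iii h hg hμ hQ hA ξ hξ hS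
  rw [traceL, Complex.add_re] at h1
  linarith

/-- **Thm. 4.7 (weak form) from `CC2021_prop_2_2_iii`, `CC2021_prop_4_5_spectral` and the §4 identity
(c) for the prolate data**: if `Σ_n λ(n)² Re⟨ζ_n | ϑ(g ∗ g*) ζ_n⟩ = A` then every finite orthonormal family
`(ξ_i)` of `S(1,1)` has `Σ_i Re⟨ξ_i | ϑ(g ∗ g*) ξ_i⟩ ≤ Re L(g ∗ g*) − A`.
[cite: ConnesConsani2021, Thm. 4.7 §4 p. 18 (proof, chunk p0018:L77–L87); Prop. 2.2 (iii) p. 10; Prop. 4.5 (iii) eq. (spectral) pp. 16–17] -/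
theorem sum_re_soninTraceForm_le_of_prop_2_2_iii_of_spectral (h : CC2021_prop_2_2_iii)
    (h' : CC2021_prop_4_5_spectral) (hg : IsWeilTest g) {A : ℝ}
    (hA : HasSum (fun n : ℕ => prolateEigen n ^ 2 *
      (soninTraceForm (weilConv g (weilReflect g)) (prolateZeta n)).re) A)
    {n : ℕ} (ξ : Fin n → Lp ℂ 2 (volume : Measure ℝ)) (hξ : Orthonormal ℂ ξ)
    (hS : ∀ i, ξ i ∈ soninSpace 1 1) :
    ∑ i, (soninTraceForm (weilConv g (weilReflect g)) (ξ i)).re ≤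
      (traceL (weilConv g (weilReflect g))).re - A :=
  sum_re_soninTraceForm_le_of_prop_2_2_iii h hg (fun n => sq_nonneg (prolateEigen n))
    (hasSum_sq_inner_prolateZeta_of_prop_4_5_spectral h') hA ξ hξ hS

/-- **The `hTr` / `CC2021_thm_4_7_weak` shape from `CC2021_prop_2_2_iii`, `CC2021_prop_4_5_spectral` and
the integrated §4 identity** `Σ_n λ(n)² Re⟨ζ_n | ϑ(g ∗ g*) ζ_n⟩ = Re D(g ∗ g*) − E` (supplied, with
`E = Re evenFunctional (ε ∘ exp) (g ∗ g*)`, by `ArchimedeanTraceFormulaProofs.hasSum_re_soninTraceForm_prolate`):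
every finite orthonormal family `(ξ_i)` of `S(1,1)` has `Σ_i Re⟨ξ_i | ϑ(g ∗ g*) ξ_i⟩ ≤ Re W_∞(g ∗ g*) + E`.
[cite: ConnesConsani2021, Thm. 4.7 §4 p. 18 (statement (sonine0) and proof, chunk p0018:L33–L87)] -/
theorem soninTrace_partial_le_archW_add_of_spectral (h : CC2021_prop_2_2_iii)
    (h' : CC2021_prop_4_5_spectral) (hg : IsWeilTest g) {E : ℝ}
    (hA : HasSum (fun n : ℕ => prolateEigen n ^ 2 *
      (soninTraceForm (weilConv g (weilReflect g)) (prolateZeta n)).re)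
      ((remainderD (weilConv g (weilReflect g))).re - E))
    {n : ℕ} (ξ : Fin n → Lp ℂ 2 (volume : Measure ℝ)) (hξ : Orthonormal ℂ ξ)
    (hS : ∀ i, ξ i ∈ soninSpace 1 1) :
    ∑ i, (soninTraceForm (weilConv g (weilReflect g)) (ξ i)).re ≤
      (archW (weilConv g (weilReflect g))).re + E :=
  soninTrace_partial_le_archW_add h hg (fun n => sq_nonneg (prolateEigen n))
    (hasSum_sq_inner_prolateZeta_of_prop_4_5_spectral h') hA ξ hξ hS

end Reduction

/-! ## `𝓕⁻ = 𝓕` and `𝓕𝓕 = 1` on `L²(ℝ)_ev` (from `Analysis/Fourier/L2FourierReflection`) -/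

section EvenFourierInversion

/-- An even `u` is fixed by the reflection `R` (in the `Lp.compMeasurePreserving` spelling of
`Analysis/Fourier/L2FourierReflection`). [cite: ConnesConsaniMoscovici2024, Def. 4.5 §4.6 p. 14] -/
theorem compNeg_eq_self_of_mem_evenPart {u : Lp ℂ 2 (volume : Measure ℝ)} (hu : u ∈ evenPart) :
    Lp.compMeasurePreserving (fun x : ℝ => -x) (Measure.measurePreserving_neg (volume : Measure ℝ)) u
      = u :=
  mem_evenPart_iff_reflect.mp hu

/-- **`𝓕⁻ u = 𝓕 u` for even `u ∈ L²(ℝ)`** (`𝓕⁻ = R𝓕 = 𝓕R` and `Ru = u`).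
[cite: ConnesConsani2021, Prop. 4.5 (iv) proof §4 p. 17 (chunk p0017:L64–L66); §4 p. 15 (chunk p0015:L42–L48)] -/
theorem fourierInv_eq_fourier_of_mem_evenPart {u : Lp ℂ 2 (volume : Measure ℝ)} (hu : u ∈ evenPart) :
    (𝓕⁻ u : Lp ℂ 2 (volume : Measure ℝ)) = (𝓕 u : Lp ℂ 2 (volume : Measure ℝ)) := by
  rw [Literature.Analysis.Fourier.fourierInv_eq_fourier_compNeg, compNeg_eq_self_of_mem_evenPart hu]

/-- **`𝓕 (𝓕 u) = u` for even `u ∈ L²(ℝ)`** (`𝓕𝓕 = R`).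
[cite: ConnesConsani2021, Prop. 4.5 (iv) proof §4 p. 17 (chunk p0017:L64–L66)] -/
theorem fourier_fourier_of_mem_evenPart {u : Lp ℂ 2 (volume : Measure ℝ)} (hu : u ∈ evenPart) :
    (𝓕 (𝓕 u : Lp ℂ 2 (volume : Measure ℝ)) : Lp ℂ 2 (volume : Measure ℝ)) = u := by
  rw [Literature.Analysis.Fourier.fourier_fourier_eq_compNeg, compNeg_eq_self_of_mem_evenPart hu]

/-- `𝓕⁻ (𝓕⁻ u) = u` for even `u ∈ L²(ℝ)`. [cite: ConnesConsani2021, Prop. 4.5 (iv) proof §4 p. 17 (chunk p0017:L64–L66)] -/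
theorem fourierInv_fourierInv_of_mem_evenPart {u : Lp ℂ 2 (volume : Measure ℝ)} (hu : u ∈ evenPart) :
    (𝓕⁻ (𝓕⁻ u : Lp ℂ 2 (volume : Measure ℝ)) : Lp ℂ 2 (volume : Measure ℝ)) = u := by
  rw [Literature.Analysis.Fourier.fourierInv_fourierInv_eq_compNeg, compNeg_eq_self_of_mem_evenPart hu]

end EvenFourierInversion

end Literature.NumberTheory.ConnesConsani2021

end
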